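import Literature.MathematicalPhysics.QuantumFieldTheory.Balaban1983to89.B15DeterminingSets

/-!
# `Balaban1983to89.B16Sect1Backgrounds` — T. Bałaban, *Large field renormalization. II. Localization, exponentiation,
and bounds for the 𝐑 operation*, Commun. Math. Phys. **122** (1989) 355–392 [Balaban1989LargeFieldII], Sect. 1: the
BACKGROUND CONFIGURATIONS of the localization procedure and their exponential-chart representations — (1.3), (1.16),
(1.19), (1.22), (1.25), (1.35), (1.36), (1.50)–(1.54), (1.56)–(1.58), (1.60) — typed as concrete objects / `Prop`s over
the determining-set calculus of `…B15DeterminingSets` and an explicit exponential chart of the gauge group; (1.25), (1.60)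
and the first member of (1.58) PROVED

statement-level skeleton of published theorems with citation tags; proofs where landed; nothing here is a claim about
the Yang–Mills mass gap

PDF held: `paper:balaban1989-cmp122-large-field-ii` (journal page = PDF page + 354); [IV] = [Balaban1989LargeFieldI]
(CMP **122** 175–202, journal page = PDF page + 174), [III] = [Balaban1988Convergent], [15] = [Balaban1985Variational],
[12] = [Balaban1985Averaging], [13] = [Balaban1985BackgroundPropagators].  Every quotation below was READ AS AN IMAGE by
this seat on the x4 renders `run/shared/lean/pub/pub-balaban/b2b-balaban-ref1/pages/1989-cmp122-large-field-II/
…-p003,p006,p007,p008,p011,p016,p017,p018,p019-x4.png` (pp. 357, 360–362, 365, 370–373) and `…/1989-cmp122-large-field-I/…-p023-x4.png`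
([IV] p. 197).

CITATION HEADER / WHAT IS REPRODUCED (mega-formalization `lit-balaban`, reader/typer r13 gen 3; HOME
`run/shared/lean/pub/lit-balaban/`, rows `lit-balaban-r13/ROWS-B16.md` v2.2): SKELETON rows **B16.Eq1.3, B16.Eq1.16,
B16.Eq1.19, B16.Eq1.22, B16.Eq1.25, B16.Eq1.35, B16.Eq1.36, B16.Eq1.50, B16.Eq1.51, B16.Eq1.52, B16.Eq1.53, B16.Eq1.54,
B16.Eq1.56, B16.Eq1.57, B16.Eq1.58, B16.Eq1.60**
(all `absent` at SKELETON v3.12: "reader level — background-field identities whose objects the tree carries only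
abstractly"; NE-cited loci F-T4-165/210/223/224), now written over r12's CONCRETE carriers of `…B15DeterminingSets`
(`DetSet`, `DetBackground` = the solution map `(𝐁, V) ↦ U(𝐁, V)` of [III] (2.12) as data, `join214` = [III] (2.14),
`splice`/`spliceAt`, `avgFamily` = `M˙(·)` of [III] (2.11), `pts`, `bondsOf`, `embIter`).

PART A is the vocabulary these displays are written in and which the tree lacked (`lit-balaban-r12/INTERFACES-r12.md`,
open request (b): *"a named ℍ-operator interface … rows r12:1.30–1.45, 1.56–1.58, 1.85–1.93 all reduce to it"*): an
EXPLICIT EXPONENTIAL CHART `A ↦ exp iA`, `W ↦ (1/i) log W` of the gauge group as DATA (`ExpChart`), the bondwise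
perturbation `exp(iA)·U` (`expMul`), the datum quotient `(1/i) log[W V⁻¹]` (`ilogRatio`), restriction of a chart field to
a region (`msRestrict`), gauge transformations acting scale-wise (`msGaugeAct`, `toMS`), equality of configurations ON A
DOMAIN (`EqOn0`), and the one `Prop` shape every representation (1.16), (1.19), (1.22), (1.51), (1.54), (1.57), (1.58)
([IV] (1.86)) instantiates — `IsRepr`: *"U(V′V₀)U(V₀)⁻¹ transformed to the Landau gauge is, by the definition, equal to
exp iη𝓗(B), where B = (1/i) log V′"* ([15] Prop. 9 p. 309, the tree's abstract `…B11.Prop9Printed`/`AnData.HDet`), here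
as the concrete equation `fam B = (exp iη𝓗(B) · base)^{u(B)⁻¹}` between configurations on `T_η`, with the function 𝓗
and the gauge `u` as explicit arguments (they are DEFINED by this representation given the gauge fixing — [15] Prop. 9
"by the definition" — and their analyticity/decay is [15] Prop. 9 / (190), NOT asserted here).

PART B types the rows over ONE data carrier `Sect1Data` (ref-1 F6: the regions `Λ, Z, Ω″_k, Z″_k, Ω″˜_{h+1}, Ω″˜²_{h+1},
…`, the determining sets `𝐁_k, 𝐁″_k, 𝐁″_k(Z), 𝐁_h(Ω″˜_{h+1}), 𝐁_h((Ω″˜_{h+1})ᶜ), 𝐁_h(Ω″˜²_{h+1})` of [IV] §1 / [III]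
(2.13), the fields `V, V″, V′_k, V_Λ^{(A)}`, the background `U₀` of [IV] (1.79) with its axial–Landau gauge `u₀` of [IV]
(1.86), the coupling `g_k` — all explicit DATA, no standing assumption smuggled).  Identities whose content is the
existence of the representing pair (𝓗, u) are `def …: Prop` over that pair; configurations DEFINED by a display are real
`def`s; **(1.60)** is PROVED from (1.51) and the gauge
invariance of `𝐄^{(j)}(X, ·, z)`; **(1.25)** is PROVED from its three printed inputs (gauge covariance of `M˙`, covariance (181) [15] of the
solution map, the reproducing identity `U_{𝐁₁}(M˙(U₀)) = U₀`) and the gauge group law; the first member of **(1.58)**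
(`V′_k⁻¹V′_kV_Λ^{(A)} = V_Λ^{(A)}`) is PROVED; the in-range gauge covariance of the iterated averages is PROVED from
`Setup.Averaging.covariant` (`iter_gaugeAct`).  NOT typed here (stay `absent` with reason): (1.59) and the second members of (1.61)–(1.63) (they average the
chart representation — `exp iQ˙(η𝐇″_k(g_kB))M˙(U⁰_k)`, `(u)₋⁻¹ exp iQ̃˙(η𝐇) R((u)₊) M˙(·)`: [12] (26)/(106) carriers
absent), (1.64) (notation), the expansions (1.17)/(1.20)/(1.24) of the Wilson action (their bounds are rows `B16.Txt@361V/362` of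
`…B16Sect1Statements`).  No `sorry`, no new axiom; nothing printed is asserted as a fact.
-/

open Set

namespace Literature.MathematicalPhysics.QuantumFieldTheory.Balaban1983to89.B16Sect1Backgrounds

open B15DeterminingSets GaugeField

variable {P : Params}

/-! ## Part A. The exponential chart of the gauge group and the representation shape of [15] Prop. 9 -/

/-- An EXPONENTIAL CHART of the gauge group as DATA: `iexp A = exp iA ∈ G` for `A` in the Lie algebra `𝔤` (or `𝔤ᶜ`)
and `ilog W = (1/i) log W ∈ 𝔤`, with `exp i0 = 1`, `(1/i) log 1 = 0` — the letters of p. 360, verbatim: *"The field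
V′ = exp ig_kB is small, more precisely |B| < g_k⁻¹δ′_k"*, and of the arguments *"(1/i) log[M˙(U″_k)(M˙(Q_k^{s*}V_k))⁻¹]"*
of (1.16), *"−(1/i) log V′_k↾_Λ"* of (1.58).  Only the two normalisations are recorded (the matrix model is not fixed,
`Setup.GaugeGroup` DIVERGENCE F4); inverse properties on a neighbourhood of `1` are hypotheses where needed.
[cite: Balaban1989LargeFieldII, (1.19) p.360] -/
structure ExpChart (G : Type*) [GaugeGroup G] (𝔤 : Type*) [AddCommGroup 𝔤] [Module ℝ 𝔤] where
  iexp : 𝔤 → G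
  ilog : G → 𝔤
  iexp_zero : iexp 0 = 1
  ilog_one : ilog 1 = 0

/-- A multi-scale `𝔤`-valued vector field `{A_j}`, `A_j` on the bonds of `T^{(j)}` — the chart coordinates `B`, `A` of
fields on a determining set (p. 360 *"V′ = exp ig_kB"* on `𝐁₀`; companion of `B15DeterminingSets.MSField`).
[cite: Balaban1989LargeFieldII, (1.19) p.360] -/
abbrev MSVecField (P : Params) (𝔤 : Type*) : Type _ := (j : ℕ) → VecField P j 𝔤

/-- A multi-scale gauge transformation `{u_j}`, `u_j : T^{(j)} → G` (the restrictions of a gauge transformation of `T_η`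
to the coarser lattices, p. 362 *"equal to u₀ at centers of the blocks, i.e., on 𝐁₁"*). [cite: Balaban1989LargeFieldII, (1.25) p.362] -/
abbrev MSGaugeTransf (P : Params) (G : Type*) : Type _ := (j : ℕ) → GaugeTransf P j G

section Chart

variable {G : Type*} [GaugeGroup G] {𝔤 : Type*} [AddCommGroup 𝔤] [Module ℝ 𝔤] (ch : ExpChart G 𝔤) {j : ℕ}

/-- The bondwise perturbation `(exp iA)·U : b ↦ exp(iA(b)) U(b)` — the products *"exp iη𝐇″_{k,Z}(…)U″_{k,Z}"* of (1.16),
*"exp ig_kBM˙(U₀)"* of (1.19), *"V′V₀"* of [15] Prop. 9. [cite: Balaban1989LargeFieldII, (1.16) p.360] -/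
def expMul (A : VecField P j 𝔤) (U : GaugeField P j G) : GaugeField P j G := fun b => ch.iexp (A b) * U b

/-- Scale-wise `(exp iA)·V` for multi-scale data (`exp ig_kB M˙(U₀^{(AL)})` of (1.50)). [cite: Balaban1989LargeFieldII, (1.50) p.370] -/
def msExpMul (A : MSVecField P 𝔤) (V : MSField P G) : MSField P G := fun i => expMul ch (A i) (V i)

/-- `(1/i) log[W V⁻¹]` bondwise — the chart coordinate of the datum `W` relative to `V` (the arguments of `𝐇″_{k,Z}` in
(1.16) and of `𝐇_{𝐁₁}` in (1.22)). [cite: Balaban1989LargeFieldII, (1.16) p.360] -/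
def ilogRatio (W V : GaugeField P j G) : VecField P j 𝔤 := fun b => ch.ilog (W b * (V b)⁻¹)

/-- Scale-wise `(1/i) log[W V⁻¹]` for multi-scale data. [cite: Balaban1989LargeFieldII, (1.16) p.360] -/
def msILogRatio (W V : MSField P G) : MSVecField P 𝔤 := fun i => ilogRatio ch (W i) (V i)

/-- `(1/i) log W` scale-wise (`V = 1`): the arguments *"−(1/i) log M˙(U_{k,Λ})↾_{Z″_k}"* of (1.57) and
*"−(1/i) log V′_k↾_Λ"* of (1.58) are `−` this, restricted. [cite: Balaban1989LargeFieldII, (1.57) p.371] -/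
def msILog (W : MSField P G) : MSVecField P 𝔤 := fun i b => ch.ilog (W i b)

/-- `(exp i0)·U = U`. [cite: Balaban1989LargeFieldII, (1.19) p.360] -/
@[simp] theorem expMul_zero (U : GaugeField P j G) : expMul ch (0 : VecField P j 𝔤) U = U := by
  funext b; simp [expMul, ch.iexp_zero]

/-- `(exp i0)·V = V` scale-wise — *"U⁰_k is the configuration in (1.50) with B = 0"* rests on it. [cite: Balaban1989LargeFieldII, (1.51) p.370] -/
@[simp] theorem msExpMul_zero (V : MSField P G) : msExpMul ch (0 : MSVecField P 𝔤) V = V := by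
  funext i; exact expMul_zero ch (V i)

/-- `(1/i) log[V V⁻¹] = 0`: the chart coordinate of an unperturbed datum vanishes. [cite: Balaban1989LargeFieldII, (1.16) p.360] -/
@[simp] theorem ilogRatio_self (V : GaugeField P j G) : ilogRatio ch V V = 0 := by
  funext b; simp [ilogRatio, ch.ilog_one]

/-- Scale-wise form of `ilogRatio_self`. [cite: Balaban1989LargeFieldII, (1.16) p.360] -/
@[simp] theorem msILogRatio_self (V : MSField P G) : msILogRatio ch V V = 0 := by
  funext i; exact ilogRatio_self ch (V i)

end Chart

section FieldAlgebra

variable {G : Type*} [GaugeGroup G] {𝔤 : Type*} [AddCommGroup 𝔤] [Module ℝ 𝔤] {j : ℕ}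

/-- Bondwise product `W·V` of two configurations of one scale (the products `V′V₀`, `V′_k⁻¹V′_kV_Λ^{(A)}` of (1.19),
(1.58)). [cite: Balaban1989LargeFieldII, (1.58) p.371] -/
def mulCfg (W V : GaugeField P j G) : GaugeField P j G := fun b => W b * V b

/-- Bondwise inverse `V⁻¹` (the `(M˙(U₀^{(AL)}))⁻¹`, `V′_k⁻¹` of (1.22), (1.58)). [cite: Balaban1989LargeFieldII, (1.58) p.371] -/
def invCfg (V : GaugeField P j G) : GaugeField P j G := fun b => (V b)⁻¹

/-- Scale-wise product of multi-scale data. [cite: Balaban1989LargeFieldII, (1.58) p.371] -/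
def msMul (W V : MSField P G) : MSField P G := fun i => mulCfg (W i) (V i)

/-- Scale-wise inverse of multi-scale data. [cite: Balaban1989LargeFieldII, (1.58) p.371] -/
def msInv (V : MSField P G) : MSField P G := fun i => invCfg (V i)

/-- `V⁻¹·(V·W) = W` bondwise — the first member of (1.58), *"U_k(V″↾_{Λᶜ}, V′_k⁻¹V′_kV_Λ^{(A)})"* `= U_k(V″↾_{Λᶜ}, V_Λ^{(A)})`.
[cite: Balaban1989LargeFieldII, (1.58) p.371] -/
theorem msMul_msInv_msMul (V W : MSField P G) : msMul (msInv V) (msMul V W) = W := by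
  funext i b; simp [msMul, msInv, mulCfg, invCfg]

/-- `[W V⁻¹]·V = W` bondwise — the datum of the first member of (1.22), *"[M˙(U⁰_{k,Z})(M˙(U₀^{(AL)}))⁻¹]M˙(U₀^{(AL)})"*
`= M˙(U⁰_{k,Z})`. [cite: Balaban1989LargeFieldII, (1.22) p.361] -/
theorem msMul_msMul_msInv (W V : MSField P G) : msMul (msMul W (msInv V)) V = W := by
  funext i b; simp [msMul, msInv, mulCfg, invCfg]

open Classical in
/-- Restriction `A↾_X` of a multi-scale chart field to (the bonds meeting) a region `X ⊂ T_η`, zero elsewhere — the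
restrictions *"↾_{Z∖Z^{∼−1}}"* (1.16), *"↾_{Z″_k∩Ω″˜²_{h+1}}"* (1.54), *"↾_{Z″_k}"* (1.57), *"↾_Λ"* (1.58).
[cite: Balaban1989LargeFieldII, (1.16) p.360] -/
noncomputable def msRestrict (X : Set (Site P 0)) (A : MSVecField P 𝔤) : MSVecField P 𝔤 :=
  fun i b => if b ∈ bondsOf (pts i X) then A i b else 0

/-- The inverse gauge transformation `x ↦ u(x)⁻¹` (the exponents `u″⁻¹`, `u_{k,Z}⁻¹`, `u₁⁻¹`, … of (1.16)–(1.58)).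
[cite: Balaban1989LargeFieldII, (1.16) p.360] -/
def invG (u : GaugeTransf P j G) : GaugeTransf P j G := fun x => (u x)⁻¹

/-- Pointwise product `x ↦ ū₀(x)u₀(x)⁻¹`-style of two gauge transformations (the exponent `ū₀u₀⁻¹` of (1.25)).
[cite: Balaban1989LargeFieldII, (1.25) p.362] -/
def mulG (u v : GaugeTransf P j G) : GaugeTransf P j G := fun x => u x * v x

/-- The restrictions `{u↾_{T^{(j)}}}_j` of a gauge transformation of `T_η` to the coarse lattices (via
`B15DeterminingSets.embIter`) — how `u₀` acts on the multi-scale datum `M˙(U₀)` in (1.25). [cite: Balaban1989LargeFieldII, (1.25) p.362] -/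
def toMS (u : GaugeTransf P 0 G) : MSGaugeTransf P G := fun i y => u (embIter i y)

/-- Scale-wise gauge action on multi-scale data: `(M˙(U₀))^{u}` of (1.25). [cite: Balaban1989LargeFieldII, (1.25) p.362] -/
def msGaugeAct (u : MSGaugeTransf P G) (V : MSField P G) : MSField P G := fun i => gaugeAct (u i) (V i)

/-- COMPOSITION of gauge transformations ([12] (8)): `(U^{v})^{u} = U^{uv}` with `(uv)(x) = u(x)v(x)`.
[cite: Balaban1985Averaging, (8) p.18] -/
theorem gaugeAct_gaugeAct (u v : GaugeTransf P j G) (U : GaugeField P j G) :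
    gaugeAct u (gaugeAct v U) = gaugeAct (mulG u v) U := by
  funext b; simp only [gaugeAct, mulG, mul_inv_rev, mul_assoc]

/-- `(U^{u₀})^{ū₀u₀⁻¹} = U^{ū₀}` — the last step of (1.25), verbatim: *"= U₀^{ū₀} = (U₀^{(AL)})^{ū₀u₀⁻¹}"*.
[cite: Balaban1989LargeFieldII, (1.25) p.362] -/
theorem gaugeAct_mulG_invG_gaugeAct (ubar u₀ : GaugeTransf P j G) (U : GaugeField P j G) :
    gaugeAct (mulG ubar (invG u₀)) (gaugeAct u₀ U) = gaugeAct ubar U := by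
  rw [gaugeAct_gaugeAct]
  congr 1
  funext x; simp [mulG, invG, mul_assoc]

/-- Equality of two configurations of `T_η` ON A DOMAIN `X` (on the bonds meeting `X`) — the qualified equalities *"It is
supported in the domain Z∩Ω″˜²_{h+1}, and on this domain we have U⁰_{k,Z} = …"* (1.22), *"U_{1,2} = U₁ on Ω″˜_{h+1}"* (1.53).
[cite: Balaban1989LargeFieldII, (1.22) p.361] -/
def EqOn0 (X : Set (Site P 0)) (U U' : GaugeField P 0 G) : Prop := ∀ b ∈ bondsOf (pts 0 X), U b = U' b

omit [GaugeGroup G] in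
/-- `EqOn0` is reflexive. [cite: Balaban1989LargeFieldII, (1.22) p.361] -/
theorem EqOn0.refl {X : Set (Site P 0)} (U : GaugeField P 0 G) : EqOn0 X U U := fun _ _ => rfl

omit [GaugeGroup G] in
/-- `EqOn0` is transitive. [cite: Balaban1989LargeFieldII, (1.22) p.361] -/
theorem EqOn0.trans {X : Set (Site P 0)} {U U' U'' : GaugeField P 0 G} (h : EqOn0 X U U') (h' : EqOn0 X U' U'') :
    EqOn0 X U U'' := fun b hb => (h b hb).trans (h' b hb)

/-- A gauge transformation acts bondwise, hence preserves equality on a domain. [cite: Balaban1989LargeFieldII, (1.25) p.362] -/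
theorem EqOn0.gaugeAct {X : Set (Site P 0)} {U U' : GaugeField P 0 G} (h : EqOn0 X U U') (u : GaugeTransf P 0 G) :
    EqOn0 X (gaugeAct u U) (gaugeAct u U') := fun b hb => by simp only [GaugeField.gaugeAct, h b hb]

/-- GAUGE COVARIANCE OF THE ITERATED AVERAGES in the standing range of `Params`: `M^i(U^{u}) = (M^i(U))^{u↾T^{(i)}}` for
`i ≤ m + K`, by induction from the one-step axiom `Setup.Averaging.covariant` ([12] (11)) — the step *"U_{𝐁₁}(M˙(U₀^{u₀}))
= (U_{𝐁₁}(M˙(U₀)))^{ū₀}"* of (1.25) uses it scale by scale. [cite: Balaban1985Averaging, (11) p.19] -/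
theorem iter_gaugeAct (av : ∀ i, Averaging P i G) (u : GaugeTransf P 0 G) (U : GaugeField P 0 G) :
    ∀ i, i ≤ P.m + P.K → Averaging.iter av i (gaugeAct u U) = gaugeAct (toMS u i) (Averaging.iter av i U)
  | 0, _ => rfl
  | i + 1, hi => by
    have ih := iter_gaugeAct av u U i (Nat.le_of_succ_le hi)
    show (av i).avg (Averaging.iter av i (gaugeAct u U)) = gaugeAct (toMS u (i + 1)) ((av i).avg (Averaging.iter av i U))
    rw [ih, (av i).covariant hi]
    rfl

/-- THE REPRESENTATION SHAPE of [15] Prop. 9 p. 309, verbatim: *"The function U_k(V′V₀)U_k(V₀)⁻¹ transformed to the Landau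
gauge is, by the definition, equal to exp iη𝓗(B), where B = (1/i) log V′"*, written as the concrete equation between
configurations of `T_η` that (1.16), (1.19), (1.22), (1.51), (1.54), (1.57), (1.58) and [IV] (1.86) instantiate: for every
chart datum `B ∈ dom`, `fam B = (exp iη𝓗(B) · base)^{u(B)⁻¹}` — `fam B` = the minimizer for the perturbed datum, `base` =
the one for the unperturbed datum, `𝓗 = H`, and `u` = the gauge transformation to the Landau gauge, both functions of `B`
(explicit arguments: they are DEFINED by this representation given the gauge fixing; their analyticity and the decay (190)
[15] are [15] Prop. 9, the tree's `…B11.Prop9Printed`, not asserted).  `η • H B` = the field `η𝓗(B)`. [cite: Balaban1985Variational, Prop. 9 p.309] -/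
def IsRepr (ch : ExpChart G 𝔤) (η : ℝ) {X : Type*} (dom : Set X) (fam : X → GaugeField P 0 G)
    (base : GaugeField P 0 G) (H : X → VecField P 0 𝔤) (u : X → GaugeTransf P 0 G) : Prop :=
  ∀ B ∈ dom, fam B = gaugeAct (invG (u B)) (expMul ch (η • H B) base)

/-- At an unperturbed datum (`𝓗 = 0`, `u = 1`) the representation reads `fam B = base`. [cite: Balaban1985Variational, Prop. 9 p.309] -/
theorem isRepr_trivial_iff (ch : ExpChart G 𝔤) (η : ℝ) {X : Type*} (dom : Set X) (fam : X → GaugeField P 0 G)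
    (base : GaugeField P 0 G) :
    IsRepr ch η dom fam base (fun _ => 0) (fun _ _ => 1) ↔ ∀ B ∈ dom, fam B = base := by
  have h0 : gaugeAct (invG fun _ : Site P 0 => (1 : G)) (expMul ch (η • (0 : VecField P 0 𝔤)) base) = base := by
    rw [smul_zero, expMul_zero]
    funext b
    simp [GaugeField.gaugeAct, invG]
  unfold IsRepr
  simp only [h0]

end FieldAlgebra

/-! ## Part B. The data of Sect. 1 and the rows -/

/-- The DATA over which the background configurations of Sect. 1 are written (ref-1 F6: explicit carriers, no standing
assumption inside).  Regions are subsets of the fine lattice `T_η = Site P 0` (READING (a) of `…B15DeterminingSets`);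
determining sets are `B15DeterminingSets.DetSet`s; the solution map `U(𝐁, ·)` is `bg : DetBackground`.  Field by field
(pages of [Balaban1989LargeFieldII] unless marked [IV]): `k`, `h` the current and the first large-field scale ([IV] §1);
`gk` = `g_k`; `η` = the fine spacing `η`; `Λ` (the large-field region of [IV] Prop. 1, p. 357 *"Λ is a rectangular
parallelepiped contained in a cube of the size 100M"*), `Z` (p. 360), `Zm1` = `Z^{∼−1}` (p. 360), `Zm3` = `Z^{∼−3}` and `Zm3m2` = `(Z^{∼−3})^{∼−2}` ((1.36)), `Ωk` = `Ω_k`,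
`Ωppk` = `Ω″_k`, `Zppk` = `Z″_k` ([IV] (1.10)–(1.12)), `ΩppT` = `Ω″˜_{h+1}`, `ΩppT2` = `Ω″˜²_{h+1}` (p. 360–361),
`ΩppTm2`/`ΩppTcm2`/`ΩppT2m2` = the shrunk domains `Ω^{∼−2}` entering the joins (2.14) [III] of (1.52)/(1.22); `detK` = `𝐁_k`
((1.33); [III] (2.2)), `detKZ` = `𝐁_k(Z)` and `detKZm3` = `𝐁_k(Z^{∼−3})` (the localized determining sets of [III]
(2.13)/(2.16) entering (1.3) and (1.36)), `detPP` = `𝐁″_k` ([IV] (1.13)/(1.17), `B15DeterminingSets.detSetTop`), `detPPZ` = `𝐁″_k(Z)` ([IV] (1.19)/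
(1.21), `B15DeterminingSets.detSetNZ … (k − h)`), `detHT` = `𝐁_h(Ω″˜_{h+1})`, `detHTc` = `𝐁_h((Ω″˜_{h+1})ᶜ)`, `detHT2` =
`𝐁_h(Ω″˜²_{h+1})` (the localized determining sets of [III] (2.13)); `V` = the original multi-scale field `{V_j}` and `Qs`
= `V_k ↦ Q_k^{s*}V_k` ([III] (1.3); [IV] (1.20)); `Vpp` = `V″` ([IV] (1.81)); `U₀` = the background (1.79) [IV]
(`B15DeterminingSets.bgU0`) and `u₀` = its axial–Landau gauge, [IV] p. 197: *"Thus U₀^{u₀} is in the required gauge, and we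
have U₀^{u₀} = U₀^{(AL)} = exp iη𝔸₀ inside Λ"*; `VΛ` = `V_Λ` (the minimizer of [IV] Prop. 1, p. 365: *"V_Λ is defined
on the whole set Z^{(k)}, and equal to V_k outside Λ"*), `VΛA` = `V_Λ^{(A)}` (the same in the axial gauge, (1.56)) and `Vk'`
= `V′_k` ((1.34), p. 365: *"V′_k = 1 on Λᶜ"*; (1.58)), all as multi-scale data (their scale-`k` members are the printed
fields). [cite: Balaban1989LargeFieldII, (1.50) p.370] -/
structure Sect1Data (P : Params) (G : Type*) [GaugeGroup G] (av : ∀ i, Averaging P i G) (𝔤 : Type*)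
    [AddCommGroup 𝔤] [Module ℝ 𝔤] where
  bg : DetBackground P G av
  ch : ExpChart G 𝔤
  k : ℕ
  h : ℕ
  gk : ℝ
  η : ℝ
  Λ : Set (Site P 0)
  Z : Set (Site P 0)
  Zm1 : Set (Site P 0)
  Zm3 : Set (Site P 0)
  Zm3m2 : Set (Site P 0)
  Ωk : Set (Site P 0)
  Ωppk : Set (Site P 0)
  Zppk : Set (Site P 0)
  ΩppT : Set (Site P 0)
  ΩppT2 : Set (Site P 0)
  ΩppTm2 : Set (Site P 0)
  ΩppTcm2 : Set (Site P 0)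
  ΩppT2m2 : Set (Site P 0)
  detK : DetSet P
  detKZ : DetSet P
  detKZm3 : DetSet P
  detPP : DetSet P
  detPPZ : DetSet P
  detHT : DetSet P
  detHTc : DetSet P
  detHT2 : DetSet P
  V : MSField P G
  Qs : GaugeField P k G → GaugeField P 0 G
  Vpp : MSField P G
  U₀ : GaugeField P 0 G
  u₀ : GaugeTransf P 0 G
  VΛ : MSField P G
  VΛA : MSField P G
  Vk' : MSField P G

namespace Sect1Data

noncomputable section

variable {G : Type*} [GaugeGroup G] {av : ∀ i, Averaging P i G} {𝔤 : Type*} [AddCommGroup 𝔤] [Module ℝ 𝔤]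
variable (D : Sect1Data P G av 𝔤)

/-! ### [IV] (1.86): the axial–Landau representative `U₀^{(AL)}` -/

/-- `U₀^{(AL)} = U₀^{u₀}` — [IV] p. 197 [PDF 23], verbatim: *"Thus U₀^{u₀} is in the required gauge, and we have
U₀^{u₀} = U₀^{(AL)} = exp iη𝔸₀ inside Λ"*. [cite: Balaban1989LargeFieldI, (1.86) p.197] -/
def U0AL : GaugeField P 0 G := gaugeAct D.u₀ D.U₀

/-! ### (1.3): the constrained variational problem solved by `U₀` -/

/-- **(1.3)** p. 357 [PDF 3], verbatim: *"To consider the second term in the exponential we make the following remark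
about the configuration U₀. It is a minimum of the functional U → A(U), for U : U defined and regular on Z,
M_{𝐁_k}(U) = M_{𝐁_k(Z)}(Q_k^{s*}V_k) on Z∖Λ. (1.3)"* — in the determining-set calculus of [III] (2.12)
(`B15DeterminingSets.IsMinimizer`): `U₀` lies in the regular class, its averages agree with those of `Q_k^{s*}V_k` on the
members of `𝐁_k(Z)` inside `Z∖Λ`, and it minimizes the Wilson action among such configurations.  A `Prop` (its content is
[IV] Prop. 1 with (1.79) [IV]; not asserted). [cite: Balaban1989LargeFieldII, (1.3) p.357] -/
def IsMin13 : Prop :=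
  IsMinimizer av D.bg.reg (D.detKZ.restrict (D.Z \ D.Λ)) (avgFamily av (D.Qs (D.V D.k))) D.U₀

/-! ### (1.35), (1.36): the new background `U_k` and the representation inverse to (1.16) -/

/-- The new gauge field variables of (1.34) p. 365, verbatim: *"On this determining set we define new gauge field
variables V: V↾_{Zᶜ} = V″↾_{Zᶜ}, V↾_Z = V′_kV_Λ↾_Z. (1.34) Let us recall that V′_k = 1 on Λᶜ, and V_Λ is defined on the
whole set Z^{(k)}, and equal to V_k outside Λ."* (row B16.Eq1.34 is typed in `…B16Sect1Wilson`; here the datum itself).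
[cite: Balaban1989LargeFieldII, (1.34) p.365] -/
noncomputable def data134 : MSField P G := splice D.Zᶜ D.Vpp (msMul D.Vk' D.VΛ)

/-- **(1.35)** p. 365 [PDF 11], verbatim: *"Now we introduce a new determining set 𝐁_k, and a new background field U_k.
… The new background field U_k is defined by U_k = U_{𝐁_k}(V). (1.35)"* — `U_k = U(𝐁_k, V)` with the `V` of (1.34).
[cite: Balaban1989LargeFieldII, (1.35) p.365] -/
noncomputable def cfgK135 : GaugeField P 0 G := D.bg.U D.detK D.data134

/-- The determining set `𝐁″_k∪𝐁_k(Z^{∼−3})` of (1.36) (join (2.14) [III], `join214`). [cite: Balaban1989LargeFieldII, (1.36) p.365] -/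
def detPPZm3 : DetSet P := join214 D.detPP D.detKZm3 D.Zm3 D.Zm3m2

/-- `U″_{k,Z^{∼−3}}` — the first member of (1.36), verbatim: *"U″_{k,Z^{∼−3}} = U(𝐁″_k∪𝐁_k(Z^{∼−3}),
[M˙(Q_k^{s*}V_k)(M˙(U_k))⁻¹]M˙(U_k))"*, the datum written as printed (it is `M˙(Q_k^{s*}V_k)`, `cfgPPZm3_eq`).
[cite: Balaban1989LargeFieldII, (1.36) p.365] -/
noncomputable def cfgPPZm3 : GaugeField P 0 G :=
  D.bg.U D.detPPZm3
    (msMul (msMul (avgFamily av (D.Qs (D.V D.k))) (msInv (avgFamily av D.cfgK135))) (avgFamily av D.cfgK135))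

/-- The printed datum of (1.36) IS `M˙(Q_k^{s*}V_k)` (bondwise group law). [cite: Balaban1989LargeFieldII, (1.36) p.365] -/
theorem cfgPPZm3_eq : D.cfgPPZm3 = D.bg.U D.detPPZm3 (avgFamily av (D.Qs (D.V D.k))) := by
  rw [cfgPPZm3, msMul_msMul_msInv]

/-- The chart argument of (1.36): `−(1/i) log[M˙(U_k)(M˙(Q_k^{s*}V_k))⁻¹]` — p. 365: *"The argument of the 𝐇-function above
has a support in the boundary layer of the width 2M₁ at the boundary ∂Z^{∼−3}, and it is bounded by 44d²ε_k."*
[cite: Balaban1989LargeFieldII, (1.36) p.365] -/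
def arg136 : MSVecField P 𝔤 := -msILogRatio D.ch (avgFamily av D.cfgK135) (avgFamily av (D.Qs (D.V D.k)))

/-- **(1.36)** p. 365 [PDF 11], verbatim: *"We expand the configuration U″_{k,Z^{∼−3}} on the support of 1 − ζ₀ around the
new background field U_k. We use a representation inverse to (1.16), i.e., we write U″_{k,Z^{∼−3}} =
U(𝐁″_k∪𝐁_k(Z^{∼−3}), [M˙(Q_k^{s*}V_k)(M˙(U_k))⁻¹]M˙(U_k)) = (exp iη𝐇″_{k,Z^{∼−3}}(−(1/i) log[M˙(U_k)(M˙(Q_k^{s*}V_k))⁻¹])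
U_k)^{u_k⁻¹}. (1.36)"* — over the representing pair (`H` = `𝐇″_{k,Z^{∼−3}}`, `u` = `u_k`) at the datum `arg136`, base the
`U_k` of (1.35). [cite: Balaban1989LargeFieldII, (1.36) p.365] -/
def Repr136 (H : MSVecField P 𝔤 → VecField P 0 𝔤) (u : MSVecField P 𝔤 → GaugeTransf P 0 G) : Prop :=
  D.cfgPPZm3 = gaugeAct (invG (u D.arg136)) (expMul D.ch (D.η • H D.arg136) D.cfgK135)

/-! ### (1.16): localization of `U″_k` in `Z` -/

/-- `U″_k = U(𝐁″_k, V)` ([IV] (1.18)/(1.21): `B15DeterminingSets.bgPP` for `detPP = detSetTop …`), the configuration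
localized in (1.16). [cite: Balaban1989LargeFieldII, (1.16) p.360] -/
def cfgPP : GaugeField P 0 G := D.bg.U D.detPP D.V

/-- The datum of `U″_{k,Z}` ([IV] (1.20)): `M˙(Q_k^{s*}V_k)` on `Z ∩ Ω_k`, `V` on `Z ∩ Ω_kᶜ` (and elsewhere).
[cite: Balaban1989LargeFieldI, (1.20) p.180] -/
noncomputable def dataPPZ : MSField P G := splice (D.Z ∩ D.Ωk) (avgFamily av (D.Qs (D.V D.k))) D.V

/-- `U″_{k,Z} = U(𝐁″_k(Z), (M˙(Q_k^{s*}V_k)↾_{Z∩Ω_k}, V↾_{Z∩Ω_kᶜ}))` ([IV] (1.20)–(1.21), `B15DeterminingSets.bgPPZ`), the base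
configuration of (1.16). [cite: Balaban1989LargeFieldII, (1.16) p.360] -/
noncomputable def cfgPPZ : GaugeField P 0 G := D.bg.U D.detPPZ D.dataPPZ

/-- **(1.16), first member** p. 360 [PDF 6], verbatim: *"We localize the configuration U″_k in the first term on the
right-hand side in the domain Z, i.e., we apply the representation U″_k = U″_{k,Z}(M˙(U″_k))"* — the REPRODUCING identity:
`U″_k` is the `𝐁″_k(Z)`-minimizer for the datum of its own averages `M˙(U″_k)` (`avgFamily`).  A `Prop` (it rests on the
uniqueness half of [15] Thm 1 and the nesting of the constraints; not asserted). [cite: Balaban1989LargeFieldII, (1.16) p.360] -/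
def Repro116 : Prop := D.bg.U D.detPPZ (avgFamily av D.cfgPP) = D.cfgPP

/-- The chart argument of (1.16): `(1/i) log[M˙(U″_k)(M˙(Q_k^{s*}V_k))⁻¹]↾_{Z∖Z^{∼−1}}` — p. 360: *"The argument of the function
𝐇″_{k,Z} has a support in a layer of width 2M₁ at the boundary ∂Z, and it can be bounded by 44d²ε_k"*.
[cite: Balaban1989LargeFieldII, (1.16) p.360] -/
noncomputable def arg116 : MSVecField P 𝔤 :=
  msRestrict (D.Z \ D.Zm1) (msILogRatio D.ch (avgFamily av D.cfgPP) (avgFamily av (D.Qs (D.V D.k))))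

/-- **(1.16), second member** p. 360 [PDF 6], verbatim: *"U″_k = U″_{k,Z}(M˙(U″_k)) = (exp iη𝐇″_{k,Z}((1/i) log[M˙(U″_k)
(M˙(Q_k^{s*}V_k))⁻¹]↾_{Z∖Z^{∼−1}}) U″_{k,Z})^{u″⁻¹}. (1.16)"* — over the representing pair (`H` = `𝐇″_{k,Z}`, `u` = `u″`) of
`IsRepr` evaluated at the one datum `arg116`: `U″_k = (exp iη𝐇″_{k,Z}(arg116) · U″_{k,Z})^{u″⁻¹}`.
[cite: Balaban1989LargeFieldII, (1.16) p.360] -/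
def Repr116 (H : MSVecField P 𝔤 → VecField P 0 𝔤) (u : MSVecField P 𝔤 → GaugeTransf P 0 G) : Prop :=
  D.cfgPP = gaugeAct (invG (u D.arg116)) (expMul D.ch (D.η • H D.arg116) D.cfgPPZ)

/-! ### (1.19): the expansion of `U″_{k,Z}` in `B` and the background `U⁰_{k,Z}` -/

/-- The datum family of (1.19): `exp ig_kB M˙(U₀)` on `Ω″˜²_{h+1}`, `V″` on `(Ω″˜²_{h+1})ᶜ`, as a function of the chart field
`B` (p. 360: *"V′ = exp ig_kB"*). [cite: Balaban1989LargeFieldII, (1.19) p.360] -/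
noncomputable def data119 (B : MSVecField P 𝔤) : MSField P G :=
  splice D.ΩppT2 (msExpMul D.ch (D.gk • B) (avgFamily av D.U₀)) D.Vpp

/-- `U″_{k,Z}(exp ig_kBM˙(U₀)↾_{Ω″˜²_{h+1}}, V″↾_{(Ω″˜²_{h+1})ᶜ}) = U(𝐁″_k(Z), data119 B)`. [cite: Balaban1989LargeFieldII, (1.19) p.360] -/
noncomputable def cfg119 (B : MSVecField P 𝔤) : GaugeField P 0 G := D.bg.U D.detPPZ (D.data119 B)

/-- `U⁰_{k,Z}` — p. 360, verbatim: *"We denote the new background field by U⁰_{k,Z}"* = the configuration of (1.19) at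
`B = 0`: `U″_{k,Z}(M˙(U₀)↾_{Ω″˜²_{h+1}}, V″↾_{(Ω″˜²_{h+1})ᶜ})`. [cite: Balaban1989LargeFieldII, (1.19) p.360] -/
noncomputable def bg0kZ : GaugeField P 0 G := D.cfg119 0

/-- `U⁰_{k,Z}` is `U(𝐁″_k(Z), (M˙(U₀)↾_{Ω″˜²_{h+1}}, V″↾))` (the `B = 0` datum carries no exponential factor).
[cite: Balaban1989LargeFieldII, (1.19) p.360] -/
theorem bg0kZ_eq : D.bg0kZ = D.bg.U D.detPPZ (splice D.ΩppT2 (avgFamily av D.U₀) D.Vpp) := by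
  simp only [bg0kZ, cfg119, data119, smul_zero, msExpMul_zero]

/-- **(1.19), first member** p. 360 [PDF 6], verbatim: *"The configuration U″_{k,Z} depends on V″, which is decomposed into
V′V₀ on 𝐁₀, according to (1.81) [IV]. The field V′ = exp ig_kB is small, more precisely |B| < g_k⁻¹δ′_k by the restrictions
(1.82) [IV] in the characteristic function χ′, hence we have U″_{k,Z} = U″_{k,Z}(exp ig_kBM˙(U₀)↾_{Ω″˜²_{h+1}},
V″↾_{(Ω″˜²_{h+1})ᶜ})"* — the re-expression of `U″_{k,Z}` in the variables (V″, B) of [IV] (1.81)–(1.82), for THE `B` of that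
change of variables (explicit argument). [cite: Balaban1989LargeFieldII, (1.19) p.360] -/
def Eq119a (B : MSVecField P 𝔤) : Prop := D.cfgPPZ = D.cfg119 B

/-- **(1.19), second member** p. 360 [PDF 6], verbatim: *"= (exp iη𝐇″_{k,Z}(g_kB)U″_{k,Z}(M˙(U₀)↾_{Ω″˜²_{h+1}},
V″↾_{(Ω″˜²_{h+1})ᶜ}))^{u_{k,Z}⁻¹}. (1.19)"* — the representation `IsRepr` of the family `B ↦ cfg119 B` around `U⁰_{k,Z}` with
`𝓗(B) = 𝐇″_{k,Z}(g_kB)`, on the domain `dom` of small `B` (*"|B| < g_k⁻¹δ′_k"*). [cite: Balaban1989LargeFieldII, (1.19) p.360] -/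
def Repr119 (dom : Set (MSVecField P 𝔤)) (H : MSVecField P 𝔤 → VecField P 0 𝔤)
    (u : MSVecField P 𝔤 → GaugeTransf P 0 G) : Prop :=
  IsRepr D.ch D.η dom D.cfg119 D.bg0kZ (fun B => H (D.gk • B)) u

/-! ### (1.22), (1.25): the representation of `U⁰_{k,Z}` through `𝐁₁ = 𝐁″_k(Z) ∪ 𝐁_h(Ω″˜²_{h+1})` -/

/-- The determining set of (1.22), p. 361, verbatim: *"We introduce the determining set 𝐁₁ = 𝐁″_k(Z)∪𝐁_h(Ω″˜²_{h+1}), where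
the operation of joining of two determining sets is given by (2.14) [III]"* (`join214`; NB the letter `𝐁₁` is reused with
a different meaning in (1.52), cell DIVERGENCE D-b02.2 — here `detB1loc`). [cite: Balaban1989LargeFieldII, (1.22) p.361] -/
def detB1loc : DetSet P := join214 D.detPPZ D.detHT2 D.ΩppT2 D.ΩppT2m2

/-- `U⁰_{𝐁₁} = U_{𝐁₁}(M˙(U₀^{(AL)}))` — the background of (1.24)/(1.25) (first member of (1.25)). [cite: Balaban1989LargeFieldII, (1.25) p.362] -/
def bg0B1 : GaugeField P 0 G := D.bg.U D.detB1loc (avgFamily av D.U0AL)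

/-- **(1.22), first member** p. 361 [PDF 7], verbatim: *"and we take the corresponding function U_{𝐁₁}. It is supported in
the domain Z∩Ω″˜²_{h+1}, and on this domain we have U⁰_{k,Z} = U_{𝐁₁}([M˙(U⁰_{k,Z})(M˙(U₀^{(AL)}))⁻¹]M˙(U₀^{(AL)}))"* — ON
the domain `Z ∩ Ω″˜²_{h+1}` (`EqOn0`), with the datum written as printed (`= M˙(U⁰_{k,Z})`, `datum122_eq`).
[cite: Balaban1989LargeFieldII, (1.22) p.361] -/
def Repro122 : Prop :=
  EqOn0 (D.Z ∩ D.ΩppT2) D.bg0kZ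
    (D.bg.U D.detB1loc (msMul (msMul (avgFamily av D.bg0kZ) (msInv (avgFamily av D.U0AL))) (avgFamily av D.U0AL)))

/-- The printed datum of (1.22) IS `M˙(U⁰_{k,Z})`: `[M˙(U⁰_{k,Z})(M˙(U₀^{(AL)}))⁻¹]M˙(U₀^{(AL)}) = M˙(U⁰_{k,Z})` (bondwise group
law), so `Repro122` is the reproducing identity `U⁰_{k,Z} = U_{𝐁₁}(M˙(U⁰_{k,Z}))` on `Z ∩ Ω″˜²_{h+1}`. [cite: Balaban1989LargeFieldII, (1.22) p.361] -/
theorem repro122_iff : D.Repro122 ↔ EqOn0 (D.Z ∩ D.ΩppT2) D.bg0kZ (D.bg.U D.detB1loc (avgFamily av D.bg0kZ)) := by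
  simp only [Repro122, msMul_msMul_msInv]

/-- The chart argument of (1.22): `(1/i) log[M˙(U⁰_{k,Z})(M˙(U₀^{(AL)}))⁻¹]` — p. 361: *"The argument of the function 𝐇_{𝐁₁} has
a support in the boundary layer of the width 2M₁ (in the L^{−h}-scale), at the boundary ∂Ω″˜²_{h+1}"*.
[cite: Balaban1989LargeFieldII, (1.22) p.361] -/
def arg122 : MSVecField P 𝔤 := msILogRatio D.ch (avgFamily av D.bg0kZ) (avgFamily av D.U0AL)

/-- **(1.22), second member** p. 361 [PDF 7], verbatim: *"= (exp iη𝐇_{𝐁₁}((1/i) log[M˙(U⁰_{k,Z})(M˙(U₀^{(AL)}))⁻¹])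
U_{𝐁₁}(M˙(U₀^{(AL)})))^{u₁⁻¹} (1.22)"* — on `Z ∩ Ω″˜²_{h+1}`, over the representing pair (`H` = `𝐇_{𝐁₁}`, `u` = `u₁`) at
the datum `arg122`, base `U⁰_{𝐁₁}`. [cite: Balaban1989LargeFieldII, (1.22) p.361] -/
def Repr122 (H : MSVecField P 𝔤 → VecField P 0 𝔤) (u : MSVecField P 𝔤 → GaugeTransf P 0 G) : Prop :=
  EqOn0 (D.Z ∩ D.ΩppT2) D.bg0kZ (gaugeAct (invG (u D.arg122)) (expMul D.ch (D.η • H D.arg122) D.bg0B1))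

/-- **(1.25)** p. 362 [PDF 8], verbatim: *"For the new background field U⁰_{𝐁₁} we have, by (4.87): U⁰_{𝐁₁} =
U_{𝐁₁}(M˙(U₀^{(AL)})) = U_{𝐁₁}(M˙(U₀^{u₀})) = (U_{𝐁₁}(M˙(U₀)))^{ū₀} = U₀^{ū₀} = (U₀^{(AL)})^{ū₀u₀⁻¹}, (1.25) where ū₀ is a gauge
transformation constant on blocks of the determining set 𝐁₁, and equal to u₀ at centers of the blocks, i.e., on 𝐁₁."*
("(4.87)" = (1.85)–(1.87) [IV], cell slip D-b02.1.)  PROVED on the support domain `X` from the three printed inputs, each a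
hypothesis: `hM` — gauge covariance of the averages `M˙(U₀^{u₀}) = (M˙(U₀))^{u₀↾}` ([12] (11); in the `Params` range this is
`iter_gaugeAct`); `h181` — covariance of the solution map, [15] (181) *"U_k(V^v) = U_k(V)^{v̄}"*, for `𝐁₁` and the datum
`M˙(U₀)` with the block-constant extension `ū₀`; `hrep` — the reproducing identity `U_{𝐁₁}(M˙(U₀)) = U₀` ([IV] (1.85)) on
`X`.  Conclusion: the three printed equalities `U⁰_{𝐁₁} = (U_{𝐁₁}(M˙(U₀)))^{ū₀} = U₀^{ū₀} = (U₀^{(AL)})^{ū₀u₀⁻¹}` on `X`.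
[cite: Balaban1989LargeFieldII, (1.25) p.362] -/
theorem eq125 (X : Set (Site P 0)) (ubar : GaugeTransf P 0 G)
    (hM : avgFamily av D.U0AL = msGaugeAct (toMS D.u₀) (avgFamily av D.U₀))
    (h181 : D.bg.U D.detB1loc (msGaugeAct (toMS D.u₀) (avgFamily av D.U₀)) =
      gaugeAct ubar (D.bg.U D.detB1loc (avgFamily av D.U₀)))
    (hrep : EqOn0 X (D.bg.U D.detB1loc (avgFamily av D.U₀)) D.U₀) :
    D.bg0B1 = gaugeAct ubar (D.bg.U D.detB1loc (avgFamily av D.U₀)) ∧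
      EqOn0 X D.bg0B1 (gaugeAct ubar D.U₀) ∧
      EqOn0 X D.bg0B1 (gaugeAct (mulG ubar (invG D.u₀)) D.U0AL) := by
  have h1 : D.bg0B1 = gaugeAct ubar (D.bg.U D.detB1loc (avgFamily av D.U₀)) := by
    rw [bg0B1, hM, h181]
  refine ⟨h1, ?_, ?_⟩
  · rw [h1]; exact hrep.gaugeAct ubar
  · rw [h1, U0AL, gaugeAct_mulG_invG_gaugeAct]; exact hrep.gaugeAct ubar

/-- The hypothesis `hM` of `eq125` holds scale by scale in the standing range of `Params` (`i ≤ m + K`), from the axiom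
`Setup.Averaging.covariant` — so `hM` is the printed gauge covariance of `M˙` modulo the junk scales above `m + K`
(`Setup` RANGE GUARD, DIVERGENCE F16). [cite: Balaban1985Averaging, (11) p.19] -/
theorem avgFamily_U0AL_apply {i : ℕ} (hi : i ≤ P.m + P.K) :
    avgFamily av D.U0AL i = msGaugeAct (toMS D.u₀) (avgFamily av D.U₀) i :=
  iter_gaugeAct av D.u₀ D.U₀ i hi

/-! ### (1.50)–(1.51): `U″_k` in the new variables and its expansion in `B` -/

/-- The datum family of (1.50): `V″` on `Λᶜ`, `exp ig_kB M˙(U₀^{(AL)})` on `Λ ∩ Ω″˜²_{h+1}`, `V″` on `(Ω″˜²_{h+1})ᶜ` — i.e. the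
perturbed averages on `Λ ∩ Ω″˜²_{h+1}` and `V″` on its complement. [cite: Balaban1989LargeFieldII, (1.50) p.370] -/
noncomputable def data150 (B : MSVecField P 𝔤) : MSField P G :=
  splice (D.Λ ∩ D.ΩppT2) (msExpMul D.ch (D.gk • B) (avgFamily av D.U0AL)) D.Vpp

/-- **(1.50)** p. 370 [PDF 16], verbatim: *"U″_k = U_{𝐁″_k}(V″↾_{Λᶜ}, exp ig_kBM˙(U₀^{(AL)})↾_{Λ∩Ω″˜²_{h+1}}, V″↾_{(Ω″˜²_{h+1})ᶜ}).
(1.50) The determining set 𝐁″_k restricted to the domain Λᶜ, and the field V″↾_{Λᶜ}, coincide with the corresponding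
determining set, and the field, for the new configuration U_k."* — `U″_k` as a function of the chart field `B`.
[cite: Balaban1989LargeFieldII, (1.50) p.370] -/
noncomputable def cfg150 (B : MSVecField P 𝔤) : GaugeField P 0 G := D.bg.U D.detPP (D.data150 B)

/-- `U⁰_k` — p. 370, verbatim: *"where U⁰_k is the configuration in (1.50) with B = 0"*. [cite: Balaban1989LargeFieldII, (1.51) p.370] -/
noncomputable def bg0k : GaugeField P 0 G := D.cfg150 0

/-- `U⁰_k = U_{𝐁″_k}(V″↾_{Λᶜ}, M˙(U₀^{(AL)})↾_{Λ∩Ω″˜²_{h+1}}, V″↾)` (no exponential factor at `B = 0`). [cite: Balaban1989LargeFieldII, (1.51) p.370] -/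
theorem bg0k_eq : D.bg0k = D.bg.U D.detPP (splice (D.Λ ∩ D.ΩppT2) (avgFamily av D.U0AL) D.Vpp) := by
  simp only [bg0k, cfg150, data150, smul_zero, msExpMul_zero]

/-- **(1.51)** p. 370 [PDF 16], verbatim: *"The first expansion is with respect to B, and we have as in (1.19) U″_k =
(exp iη𝐇″_k(g_kB)U⁰_k)^{u″_k⁻¹}, (1.51) where U⁰_k is the configuration in (1.50) with B = 0."* — the representation `IsRepr`
of the family (1.50) around `U⁰_k` with `𝓗(B) = 𝐇″_k(g_kB)`, on the domain `dom` of small `B`.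
[cite: Balaban1989LargeFieldII, (1.51) p.370] -/
def Repr151 (dom : Set (MSVecField P 𝔤)) (H : MSVecField P 𝔤 → VecField P 0 𝔤)
    (u : MSVecField P 𝔤 → GaugeTransf P 0 G) : Prop :=
  IsRepr D.ch D.η dom D.cfg150 D.bg0k (fun B => H (D.gk • B)) u

/-- **(1.60)** p. 372 [PDF 18], verbatim: *"For the terms with localization domains X not contained in □^{∼2}, and for
the boundary terms in the second group, we write the following simpler identity 𝐄^{(j)}(X, U″_k, z) = 𝐄^{(j)}(X, U⁰_k, z)
+ [𝐄^{(j)}(X, exp iη𝐇″_k(g_kB)U⁰_k, z) − 𝐄^{(j)}(X, U⁰_k, z)], (1.60)"* — PROVED from the representation (1.51) at the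
datum `B` and the gauge invariance of the term `𝐄^{(j)}(X, ·, z)` ([I] (1.7)–(1.8); `Setup.GaugeField.GaugeInvariant`),
which removes the gauge transformation `u″_k⁻¹`. [cite: Balaban1989LargeFieldII, (1.60) p.372] -/
theorem eq160 {𝕜 : Type*} [AddCommGroup 𝕜] (E : GaugeField P 0 G → 𝕜) (hE : GaugeInvariant E)
    {dom : Set (MSVecField P 𝔤)} {H : MSVecField P 𝔤 → VecField P 0 𝔤} {u : MSVecField P 𝔤 → GaugeTransf P 0 G}
    (h151 : D.Repr151 dom H u) {B : MSVecField P 𝔤} (hB : B ∈ dom) :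
    E (D.cfg150 B) = E D.bg0k + (E (expMul D.ch (D.η • H (D.gk • B)) D.bg0k) - E D.bg0k) := by
  have h1 : D.cfg150 B = gaugeAct (invG (u B)) (expMul D.ch (D.η • H (D.gk • B)) D.bg0k) := h151 B hB
  rw [h1, hE]
  abel

/-! ### (1.52)–(1.53): the determining sets `𝐁₁`, `𝐁₂` and the configurations `U₁`, `U₂`, `U_{1,2}` -/

/-- **(1.52), `𝐁₁`** p. 370 [PDF 16], verbatim: *"Take the determining sets 𝐁₁ = 𝐁″_k∪𝐁_h(Ω″˜_{h+1}), 𝐁₂ =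
𝐁″_k∪𝐁_h((Ω″˜_{h+1})ᶜ), (1.52) where the operation of joining two determining sets is given by (2.14) [III]"* —
`𝐁₁ = (𝐁″_k ∩ (Ω″˜_{h+1})^{∼−2}) ∪ (𝐁_h(Ω″˜_{h+1}) ∩ (Ω″˜_{h+1}∖(Ω″˜_{h+1})^{∼−2}))` (`join214`). [cite: Balaban1989LargeFieldII, (1.52) p.370] -/
def detB1 : DetSet P := join214 D.detPP D.detHT D.ΩppT D.ΩppTm2

/-- **(1.52), `𝐁₂`**: `𝐁₂ = 𝐁″_k∪𝐁_h((Ω″˜_{h+1})ᶜ)` by (2.14) [III] with `Ω = (Ω″˜_{h+1})ᶜ` — p. 370: *"These functions are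
supported in the domains Ω″˜_{h+1}, (Ω″˜_{h+1})ᶜ correspondingly, and they are introduced in order to break the configuration
U⁰_k into two independent parts by the boundary conditions at the boundary ∂Ω″˜_{h+1}."* [cite: Balaban1989LargeFieldII, (1.52) p.370] -/
def detB2 : DetSet P := join214 D.detPP D.detHTc D.ΩppTᶜ D.ΩppTcm2

/-- The datum of `U₁` in (1.53): `V″` on `Λᶜ`, `M˙(U₀^{(AL)})` on `Λ ∩ Ω″_k` (printed: its scale-`k` member `M^k(U₀^{(AL)})`),
`1` on `Z″_k ∩ Ω″˜_{h+1}` (and elsewhere). [cite: Balaban1989LargeFieldII, (1.53) p.370] -/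
noncomputable def dataU1 : MSField P G := splice D.Λᶜ D.Vpp (splice (D.Λ ∩ D.Ωppk) (avgFamily av D.U0AL) 1)

/-- **(1.53), `U₁`** p. 370 [PDF 16], verbatim: *"Define the configurations U₁ = U_{𝐁₁}(V″↾_{Λᶜ}, M^k(U₀^{(AL)})↾_{Λ∩Ω″_k},
1↾_{Z″_k∩Ω″˜_{h+1}})"*. [cite: Balaban1989LargeFieldII, (1.53) p.370] -/
noncomputable def cfgU1 : GaugeField P 0 G := D.bg.U D.detB1 D.dataU1

/-- **(1.53), `U₂`**, verbatim: *"U₂ = U_{𝐁₂}(1↾_{(Ω″˜_{h+1})ᶜ∩Ω″˜²_{h+1}}, V″↾_{(Ω″˜²_{h+2})ᶜ})"* — `1` on `(Ω″˜_{h+1})ᶜ ∩ Ω″˜²_{h+1}`,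
`V″` elsewhere (the printed index `h + 2` of the second restriction is kept in this quotation; the datum is `V″` off the
first region either way). [cite: Balaban1989LargeFieldII, (1.53) p.370] -/
noncomputable def cfgU2 : GaugeField P 0 G := D.bg.U D.detB2 (splice (D.ΩppTᶜ ∩ D.ΩppT2) 1 D.Vpp)

/-- **(1.53), `U_{1,2}`**, verbatim: *"U_{1,2} = U₁ on Ω″˜_{h+1}, U₂ on (Ω″˜_{h+1})ᶜ. (1.53) In the configuration U_{1,2} the
arguments are separated completely across the boundary ∂Ω″˜_{h+1}. It seems to be singular on a neighborhood of this
boundary, but in fact it is regular"* (the regularity clause is cell GAPS C-adv3-84, not typed) — the fine-lattice splice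
along `Ω″˜_{h+1}` (`spliceAt`: bonds meeting `Ω″˜_{h+1}` carry `U₁`). [cite: Balaban1989LargeFieldII, (1.53) p.370] -/
noncomputable def cfgU12 : GaugeField P 0 G := spliceAt (pts 0 D.ΩppT) D.cfgU1 D.cfgU2

/-- `U_{1,2} = U₁` on `Ω″˜_{h+1}` (definitional). [cite: Balaban1989LargeFieldII, (1.53) p.370] -/
theorem cfgU12_eqOn : EqOn0 D.ΩppT D.cfgU12 D.cfgU1 := by
  intro b hb
  simp only [cfgU12, spliceAt, hb, if_true]

/-! ### (1.54): the expansion of `U⁰_k` around `U_{1,2}` -/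

/-- **(1.54)** p. 370 [PDF 16], verbatim: *"We construct the expansion of U⁰_k around the configuration U_{1,2}. From the
results of Sects. D, E [15] we obtain U⁰_k = (exp iηH″_k(G″_kJ_{1,2}, H″_{1,k}Q̃˙(ηA₀)↾_{Z″_k∩Ω″˜²_{h+1}})U_{1,2})^{(u⁰_k)⁻¹}.
(1.54) We have written explicitly the form of the operator dependence of the function 𝐇″_k on the fields J_{1,2},
Q̃_h(ηA₀). The second field is obviously localized in the domain Z″_k∩Ω″˜²_{h+1}"* — over the explicit objects of [15]
Sects. D–E: the two-argument function `H2` (`𝐇″_k(·) = H″_k(G″_k ·, H″_{1,k} ·)`), the operator `Gk` = `G″_k`, the linear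
operator `H1k` = `H″_{1,k}`, the current `J12` = `J_{1,2}` of `U_{1,2}`, the nonlinear average `Qt` = `Q̃˙`, the field `A₀`
= `𝔸₀` of [IV] (1.86) (`U₀^{(AL)} = exp iη𝔸₀`), and the gauge `u0k` = `u⁰_k`. [cite: Balaban1989LargeFieldII, (1.54) p.370] -/
def Repr154 (H2 : VecField P 0 𝔤 → VecField P 0 𝔤 → VecField P 0 𝔤) (Gk : VecField P 0 𝔤 → VecField P 0 𝔤)
    (H1k : MSVecField P 𝔤 → VecField P 0 𝔤) (J12 : VecField P 0 𝔤) (Qt : VecField P 0 𝔤 → MSVecField P 𝔤)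
    (A₀ : VecField P 0 𝔤) (u0k : GaugeTransf P 0 G) : Prop :=
  D.bg0k = gaugeAct (invG u0k)
    (expMul D.ch (D.η • H2 (Gk J12) (H1k (msRestrict (D.Zppk ∩ D.ΩppT2) (Qt (D.η • A₀))))) D.cfgU12)

/-! ### (1.56)–(1.58): `U_{k,Λ}`, the expansion of `U₁` around it, and the expansion around `U_k` -/

/-- **(1.56)** p. 371 [PDF 17], verbatim: *"Next, we expand U₁ around the configuration U_{k,Λ} = U_k(V″↾_{Λᶜ}, V_Λ^{(A)}).
(1.56) The field V_Λ^{(A)} is in the axial gauge in Λ, hence it is small inside Λ, and averages of U_{k,Λ} are also small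
there. More precisely the condition (1.84) [IV] is satisfied for it."* (`U_k(·) = U(𝐁_k, ·)`; datum `V_Λ^{(A)}` on `Λ`, `V″`
on `Λᶜ`). [cite: Balaban1989LargeFieldII, (1.56) p.371] -/
noncomputable def cfgKΛ : GaugeField P 0 G := D.bg.U D.detK (splice D.Λᶜ D.Vpp D.VΛA)

/-- The datum of the first member of (1.57): `V″` on `Λᶜ`, `M˙(U_{k,Λ})` on `Λ ∩ Ω″_k` (printed: `M^k(U_{k,Λ})`),
`(M˙(U_{k,Λ}))⁻¹M˙(U_{k,Λ})` on `Z″_k` — the last written as printed (it is `1`, `msMul_msInv_self`).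
[cite: Balaban1989LargeFieldII, (1.57) p.371] -/
noncomputable def dataU1' : MSField P G :=
  splice D.Λᶜ D.Vpp (splice (D.Λ ∩ D.Ωppk) (avgFamily av D.cfgKΛ)
    (msMul (msInv (avgFamily av D.cfgKΛ)) (avgFamily av D.cfgKΛ)))

/-- The third piece of the (1.57) datum is the trivial configuration: `(M˙(U_{k,Λ}))⁻¹M˙(U_{k,Λ}) = 1`.
[cite: Balaban1989LargeFieldII, (1.57) p.371] -/
theorem msMul_msInv_self (W : MSField P G) : msMul (msInv W) W = 1 := by
  funext i b
  show (W i b)⁻¹ * W i b = 1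
  exact inv_mul_cancel (W i b)

/-- **(1.57), first member** p. 371 [PDF 17], verbatim: *"This allows us to write U₁ = U_{𝐁₁}(V″↾_{Λᶜ}, M^k(U_{k,Λ})↾_{Λ∩Ω″_k},
(M˙(U_{k,Λ}))⁻¹M˙(U_{k,Λ})↾_{Z″_k})"* — the re-expression of the (1.53) datum of `U₁` through `U_{k,Λ}` (uses
`M^k(U₀^{(AL)}) = M^k(U_{k,Λ})` on `Λ ∩ Ω″_k`, [IV] (1.84)–(1.85); a `Prop`). [cite: Balaban1989LargeFieldII, (1.57) p.371] -/
def Eq157a : Prop := D.cfgU1 = D.bg.U D.detB1 D.dataU1'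

/-- The chart argument of (1.57): `−(1/i) log M˙(U_{k,Λ})↾_{Z″_k}` — p. 371: *"The field in the argument of the function
𝐇_{𝐁₁} has again a right localization, and the function is decaying exponentially off the domain Z″_k."*
[cite: Balaban1989LargeFieldII, (1.57) p.371] -/
noncomputable def arg157 : MSVecField P 𝔤 := msRestrict D.Zppk (-msILog D.ch (avgFamily av D.cfgKΛ))

/-- **(1.57), second member** p. 371 [PDF 17], verbatim: *"= (exp iη𝐇_{𝐁₁}(−(1/i) log M˙(U_{k,Λ})↾_{Z″_k})U_{k,Λ})^{u₁⁻¹}.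
(1.57)"* — over the representing pair (`H` = `𝐇_{𝐁₁}`, `u` = `u₁`) at the datum `arg157`, base `U_{k,Λ}`.
[cite: Balaban1989LargeFieldII, (1.57) p.371] -/
def Repr157 (H : MSVecField P 𝔤 → VecField P 0 𝔤) (u : MSVecField P 𝔤 → GaugeTransf P 0 G) : Prop :=
  D.cfgU1 = gaugeAct (invG (u D.arg157)) (expMul D.ch (D.η • H D.arg157) D.cfgKΛ)

/-- `U_k = U_k(V″↾_{Λᶜ}, V′_kV_Λ^{(A)})` — the background of the `k`-th step in the variables of (1.34)–(1.35)
(`V_k↾_Λ = V′_kV_Λ^{(A)}`), the base of (1.58). [cite: Balaban1989LargeFieldII, (1.58) p.371] -/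
noncomputable def cfgK : GaugeField P 0 G := D.bg.U D.detK (splice D.Λᶜ D.Vpp (msMul D.Vk' D.VΛA))

/-- **(1.58), first member** p. 371 [PDF 17], verbatim: *"Finally, we obtain an expansion around U_k introducing the field V′_k
into the argument of the function U_{k,Λ}. We have U_{k,Λ} = U_k(V″↾_{Λᶜ}, V′_k⁻¹V′_kV_Λ^{(A)})"* — PROVED (bondwise
`V′_k⁻¹(V′_kV_Λ^{(A)}) = V_Λ^{(A)}`). [cite: Balaban1989LargeFieldII, (1.58) p.371] -/
theorem eq158a : D.cfgKΛ = D.bg.U D.detK (splice D.Λᶜ D.Vpp (msMul (msInv D.Vk') (msMul D.Vk' D.VΛA))) := by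
  show D.bg.U D.detK (splice D.Λᶜ D.Vpp D.VΛA) = _
  rw [msMul_msInv_msMul]

/-- The chart argument of (1.58): `−(1/i) log V′_k↾_Λ`. [cite: Balaban1989LargeFieldII, (1.58) p.371] -/
noncomputable def arg158 : MSVecField P 𝔤 := msRestrict D.Λ (-msILog D.ch D.Vk')

/-- **(1.58), second member** p. 371 [PDF 17], verbatim: *"= (exp iη𝐇_k(−(1/i) log V′_k↾_Λ)U_k)^{u_{k,Λ}⁻¹}. (1.58) The
sequence of the four formulas (1.51), (1.54), (1.57), and (1.58) yields the required expansion of the configuration U″_k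
around U_k."* — over the representing pair (`H` = `𝐇_k`, `u` = `u_{k,Λ}`) at the datum `arg158`, base `U_k`.
[cite: Balaban1989LargeFieldII, (1.58) p.371] -/
def Repr158 (H : MSVecField P 𝔤 → VecField P 0 𝔤) (u : MSVecField P 𝔤 → GaugeTransf P 0 G) : Prop :=
  D.cfgKΛ = gaugeAct (invG (u D.arg158)) (expMul D.ch (D.η • H D.arg158) D.cfgK)

end

end Sect1Data

end Literature.MathematicalPhysics.QuantumFieldTheory.Balaban1983to89.B16Sect1Backgrounds
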